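import Summits.Ventures.CertifiedQuantumChemistry.Certificates.HubbardRingL4LiftPHPSD
import Summits.Ventures.CertifiedQuantumChemistry.Certificates.HubbardRingL4LiftCoeffRows
import HarnessLib

/-!
# Ventures/CertifiedQuantumChemistry — Certificates/HubbardRingL4LiftGMapRows.lean: the `G`-coefficients of the L = 4 lift
# family are the pair-valued `G`-map of its coefficients (kernel), the last coefficientwise input of the layer-2 assembly

HONEST FRAMING (verbatim): certified bounds for a stated model Hamiltonian in a stated basis; not a
claim about the real molecule beyond that model. Auxiliary objects only; no model energy is bounded here.

Seat rdm-B (gen 42; layer 2, part (a′), of the lift assembly — twin of §2 of `…LiftCoeffRows.lean` for the `G`-matrix).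
The `G`-map is LINEAR (no constant term), so along the family `G(γ(ε,δ), Γ(ε,δ)) = Σ_jk ε^j δ^k G_jk` as soon as
`G_jk = gMapP (γ_jk, Γ_jk)` for each of the coefficients `(j, k)`; these six finite identities of rational pairs
(`64 × 64` entries each, `O(1)` work per entry) are decided by the kernel here, one coefficient per `decide` (the
tables `liftGm_jk` of `…LiftPHPSD.lean` were emitted from the lift's particle–hole BLOCKS, the tables `γ_jk`, `Γ_jk` of
`…LiftPairPSD.lean` from its pair blocks; the identity was re-verified in exact arithmetic before filing,
`tools/x14-g42/verify/check_gmap.py`). With `realGm_posSemidef` (`…LiftPHPSD.lean`) this gives the `G`-condition of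
the family in the assembly file `…LiftFeasible.lean`. 0 sorry, 0 def, standard axioms.
-/

set_option linter.style.longLine false

namespace Summit.Ventures.CertifiedQuantumChemistry

namespace LiftL4

open Matrix Finset SqrtTwo DQGGap
open Literature.MathematicalPhysics.QuantumLattice

/-! ## The `G`-coefficients are the `G`-map of the coefficients (kernel) -/

/-- `G_{00} = gMapP (γ_{00}, Γ_{00})` (kernel evaluation; one coefficient per `decide`). -/
theorem liftGm_eq_gMapP00 : ∀ (I J : Fin (4 * 2 * (4 * 2))),
    toFinP (GamP (liftGm 0 0)) I J = toFinP (gMapP (gamP (liftGam 0 0)) (GamP (liftGG 0 0))) I J := by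
  decide +kernel

/-- `G_{01} = gMapP (γ_{01}, Γ_{01})` (both sides vanish; kernel evaluation). -/
theorem liftGm_eq_gMapP01 : ∀ (I J : Fin (4 * 2 * (4 * 2))),
    toFinP (GamP (liftGm 0 1)) I J = toFinP (gMapP (gamP (liftGam 0 1)) (GamP (liftGG 0 1))) I J := by
  decide +kernel

/-- `G_{10} = gMapP (γ_{10}, Γ_{10})` (kernel evaluation; one coefficient per `decide`). -/
theorem liftGm_eq_gMapP10 : ∀ (I J : Fin (4 * 2 * (4 * 2))),
    toFinP (GamP (liftGm 1 0)) I J = toFinP (gMapP (gamP (liftGam 1 0)) (GamP (liftGG 1 0))) I J := by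
  decide +kernel

/-- `G_{11} = gMapP (γ_{11}, Γ_{11})` (both sides vanish; kernel evaluation). -/
theorem liftGm_eq_gMapP11 : ∀ (I J : Fin (4 * 2 * (4 * 2))),
    toFinP (GamP (liftGm 1 1)) I J = toFinP (gMapP (gamP (liftGam 1 1)) (GamP (liftGG 1 1))) I J := by
  decide +kernel

/-- `G_{20} = gMapP (γ_{20}, Γ_{20})` (kernel evaluation; one coefficient per `decide`). -/
theorem liftGm_eq_gMapP20 : ∀ (I J : Fin (4 * 2 * (4 * 2))),
    toFinP (GamP (liftGm 2 0)) I J = toFinP (gMapP (gamP (liftGam 2 0)) (GamP (liftGG 2 0))) I J := by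
  decide +kernel

/-- `G_{21} = gMapP (γ_{21}, Γ_{21})` (kernel evaluation; one coefficient per `decide`). -/
theorem liftGm_eq_gMapP21 : ∀ (I J : Fin (4 * 2 * (4 * 2))),
    toFinP (GamP (liftGm 2 1)) I J = toFinP (gMapP (gamP (liftGam 2 1)) (GamP (liftGG 2 1))) I J := by
  decide +kernel

/-- **`G_jk = gMapP (γ_jk, Γ_jk)` for all coefficients** of the lift family (assembled). -/
theorem liftGm_eq_gMapP : ∀ (j : Fin 3) (k : Fin 2) (I J : Fin (4 * 2 * (4 * 2))),
    toFinP (GamP (liftGm j k)) I J = toFinP (gMapP (gamP (liftGam j k)) (GamP (liftGG j k))) I J := by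
  intro j k
  fin_cases j <;> fin_cases k
  exacts [liftGm_eq_gMapP00, liftGm_eq_gMapP01, liftGm_eq_gMapP10, liftGm_eq_gMapP11, liftGm_eq_gMapP20,
    liftGm_eq_gMapP21]

end LiftL4

end Summit.Ventures.CertifiedQuantumChemistry
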